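import Mathlib
import HarnessLib
import HarnessLib.Audit
import Summits.ResolutionOfSingularities.Statement
import Literature.AlgebraicGeometry.Resolution.ComponentGluing
import Literature.AlgebraicGeometry.Resolution.Blowups
import Literature.AlgebraicGeometry.Resolution.MarkedIdeals
import Literature.AlgebraicGeometry.Resolution.ProperModels
import Literature.AlgebraicGeometry.Resolution.ProperModelsFunctionField
import Literature.AlgebraicGeometry.Resolution.RationalMapsOfModels
import Literature.Barriers.ResolutionOfSingularities.DimensionFourFrontier
import HarnessLib.Audit.Status.Attr

/-!
Route: OrderCut

# Route OrderCut — merged order cut of sandwiched resolution with the dim-4 tame-order rung and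
wild-order residual

It suffices to show X = RegularRoofs ∧ PencilReduction ∧ SplitOrderReduction ∧ SplitOrderOneResolve,
and X is EXACTLY the summit
(kernel `summit_iff_split` in the draft HOME/decomp-res-lens-2/g3/OrderCut.lean). This is the MERGED
order-cut node of the cell (lens-2
gen 2 OrderOneDescent + lens-3 gen 2 PencilDomination, CRITIC-LEDGER rows 13/18 «merge, file once»).
It REFINES route Dominance's residual
SandwichedResolve (MR, stmt-ResolutionOfSingularities-24572): MR ⟺ PencilReduction ∧
SplitOrderReduction ∧ SplitOrderOneResolve (kernel
`sandwichedResolve_iff_split`), and MR for PENCIL blow-ups ⟺ SplitOrderReduction ∧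
SplitOrderOneResolve (kernel `pencilResolve_iff`, the one
EQUIV layer) ⟺ LocalOrderReduction ∧ LocalOrderOneResolve (lens-3's local cut at scheme level,
kernel `pencilResolve_iff_local`), with the exact
seam SplitOrderReduction ⟺ LocalOrderReduction ∧ Globalisation; lens-3's K-level kernel «pencils
suffice» PR_K ⟺ DOM_K rides as the by-name supports
PencilsSufficeK / DominationPencilsK. Dichotomy on base points of a pencil (g, h) on a regular Y:
GENERIC = order one (a member is a regular
parameter: maximal contact free and global-isable in every characteristic) vs SPECIAL = order ≥ 2;
gen 3 cuts the SPECIAL class once more, at the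
first open dimension 4, by the characteristic: TAME ORDER (order of the pencil ideal < p at every
point: hereditary maximal contact, coefficient
marked ideal on a regular THREEFOLD) vs WILD ORDER (order ≥ p somewhere: the whole rational bed),
kernel `pencilResolveDimFour_iff_tame_and_wild`.
RegularRoofs is Dominance's model half, carried by signature.
Lean: `RegularRoofs ∧ PencilReduction ∧ SplitOrderReduction ∧ SplitOrderOneResolve`

## Assembly
Pure logic over two tree theorems, inlined in glue.lean (14 lines): from SplitOrderReduction and
SplitOrderOneResolve build MR for pencil blow-ups
(dominate, resolve the order-one model, transport by
`ComponentGluing.Scheme.HasResolution.of_isBirational`), feed it to PencilReduction to get MR,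
then Dominance's gluing: reduce to integral X (`ComponentGluing.resolutionInChar_iff_integral`),
take a regular roof from RegularRoofs, resolve the
sandwiched Γ, transport along a. Every binder is consumed; the draft proves the converse
(`summit_iff_split`).

Rationale: WHY THIS LINE. Hironaka's characteristic-zero architecture is ORDER REDUCTION plus DESCENT TO A
HYPERSURFACE OF MAXIMAL CONTACT, and the one step that does not
transfer to characteristic p is maximal contact at order ≥ p (Kollar2007 §3.8–3.10;
[corpus:paper:cossart2011-is-there-notion-weak-maximal-contact-characteristic
p.5] «no maximal contact for the Hilbert–Samuel function in characteristic p > 0»; tree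
`Literature.Barriers.ResolutionOfSingularities.NarasimhanMaximalContact`).
On the SANDWICHED side of the Zariski bisection (Dominance: S ⟺ RR ∧ MR, MR ⟺ weak principalization
of pencils via Nagata + Chow +
Hartshorne1977 II.7.17) the invariant «order of the centre» has a first value, ONE, at which maximal
contact is free in every characteristic: a
member x ∉ 𝔪_y² of the pencil is a regular hypersurface H through the base locus, the blow-up is
{u·x = h} ∪ (a regular chart), blowing up a
regular centre C ⊂ V(x, h̄) turns u·x = h into u·x' = e^(b−1)·h' (b = ord_C h̄ ≥ 1, the marking-1
controlled transform on Bl_C H), and once h̄ is a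
normal-crossings monomial the binomial u·x = y^a is finished by blowing up the global regular
centres H ∩ E_i. So the order-one class reduces,
characteristic-free, to EMBEDDED resolution of hypersurfaces one dimension down — closed in
dimension 4 by CossartJannsenSaito2020 (embedded
resolution of surfaces in regular threefolds, tree fact `CossartJannsenSaito2020Embedded`, the same
fact that closes Dominance's rung R1 per census
I1 T-MR-spec) and open from dimension 5
([corpus:paper:hauser2024-resolving-surface-singularities-positive-characteristic p.2] «for
threefolds …
embedded resolution is still an open problem»). What is left, SplitOrderReduction, is the genuine
characteristic-p content of MR typed as an EXISTENCE
statement with a separating class (trivial on order-one inputs, where MR is open), exactly as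
RegularRoofs is certified in Dominance. Imported: Hironaka's
marked-ideal calculus (BierstoneGrigorievMilmanWlodarczyk2011 §3, tree `idealOrder`), classical
birational geometry (blow-ups by universal property,
tree `IsBlowup`); no valuation theory, no invariant beyond the order.

GEN 3 (special class cut again). Below the characteristic the char-0 engine runs verbatim: for 2 ≤ b
= ord_y I < p a z-general member has a
Tschirnhausen hypersurface of maximal contact which PERSISTS along the order-b locus of all
controlled transforms (a point off its strict
transform has a non-zero z^(b−1)-coefficient b·c, so order < b), and all later orders stay < p;
hence order reduction of the marked pencil ideal
(I, b) on the regular FOURFOLD is order reduction of its coefficient marked ideal on a regular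
THREEFOLD (Kollar2007 §3 (3.48)–(3.49); derivatives
of order ≤ b − 1 < p behave as in char 0). Marked ideals on regular threefolds in char p: a LOCAL
algorithm is in print (KawanoueMatsuki2016 =
arXiv:1205.4556 §4–5 over k = k̄, «global version to be published elsewhere»;
[corpus:arxiv-1205.4556 p.2]); 2-dimensional subschemes of any
regular ambient: CossartJannsenSaito2020, BenitoVillamayor2012 (strong monomial case). So Tame₄ is a
dimension-bounded rung two printed
theorems and ONE named seam (a global marked-ideal theorem on threefolds) away, while Wild₄ (order ≥
p) holds every open rational fourfold specimen
of the bed (CP (u₁^p, Z^p + u₃u₂^p), kangaroo charts, Moh-rise: initial forms p-th powers). Imported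
from characteristic zero: the
tame part of the maximal-contact calculus, with the explicit dictionary «b! invertible ⇔ b < p».

TAGS AND VERDICT (cell critic CRITIC-LEDGER row 23, 2026-08-30T03:54:45Z): CLEARED AS MAP — NO crux
of this route is certified WEAKER than S: SplitOrderReduction = UNDECIDED(costume-risk) ·
IDEA-NEEDED (the route's DECLARED RESIDUAL; = LocalOrderReduction ∧ Globalisation by the seam
kernel), SplitOrderOneResolve = UNDECIDED across n (G_m-fixed-locus certificate) · INSTRUMENTABLE
with the rung SplitOrderOneResolveDimFour ATTACKABLE closed-modulo-library (one
CossartJannsenSaito2020Embedded call), RegularRoofs = WEAKER-certified (shared item 24573, Dominance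
tribunal), PencilReduction = COSTUME(cite); residual-axis score 0 conceded. Gen-3 cut
PencilResolveDimFour ⟺ Tame₄ ∧ Wild₄ is a kernel-exhaustive CASE PARTITION (honest rung map, not a
difficulty split): Wild₄ = the located dim-4 core (IDEA-NEEDED, holds the whole rational bed), Tame₄
= ATTACKABLE modulo MIR₃ := global (or functorial) resolution of 3-dimensional marked ideals (J, c)
on regular threefolds over char-p fields with centres inside Sing(J, c) — UNDECIDED-in-print, port
size L if it assembles from Cutkosky 2009 Amer. J. Math. 131 Thm 1.2/1.3
[corpus:paper:doi-10-1353-ajm-0-0036] + CJS2020 + the characteristic-free monomial stage; MIR₃ is to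
be typed as its own aside at tenure (critic's request; the route opens at the 15-item cap), so that
Tame₄ ⟸ MIR₃ ∧ Globalisation₄ ∧ ports becomes a kernel target. This is the MERGED order-cut node of
the cell (lens-2 scheme-level trident + lens-3 K-level PencilResolve ⟺ RegularDomination kernel
carried as the by-name asides PencilsSufficeK / DominationPencilsK; post-birth Theorems file =
PencilDomination.lean Thms A/C + OrderCut.lean kernels), filed ONCE by the cell writer.

RANKED CRUXES. #2 SplitOrderReduction (crux) — for every prime p, field k of char p, regular
separated finite-type Y/k and reduced Γ with a separated finite-type birational b : Γ ⟶ Y that is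
the blow-up of an ideal sheaf locally generated by two sections, there are a regular separated
finite-type Y₁/k, a reduced Γ₁ with a separated finite-type birational b₁ : Γ₁ ⟶ Y₁ that is the
blow-up of an ideal sheaf locally (x, h) with (x) locally the ideal of a global effective Cartier
divisor H of order ≤ 1 at every point (a regular hypersurface), and a proper birational π : Γ₁ ⟶ Γ
(ORDER REDUCTION for pencils; EXISTENCE; the node's residual; necessity kernel
`splitOrderReduction_of_summit`). [difficulty: open-problem] (why it might fail: cannot fail unless
S fails (kernel consequence); as a TARGET it carries wild order reduction one dimension down (split
pencils (x₁^p, h); mixed pencils give z^p + F(x, w)) — IDEA-NEEDED; certified weaker than MR only by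
the separating class of order-one inputs.) [Kollar2007, BierstoneGrigorievMilmanWlodarczyk2011,
CossartPiltant2019, doi:10.4310/ajm.2011.v15.n3.a3]
#3 SplitOrderOneResolve (crux) — for every prime p, field k of char p, regular separated finite-type
Y/k and reduced Γ with a separated finite-type birational b : Γ ⟶ Y that is the blow-up of an ideal
sheaf locally (x, h) with (x) locally the ideal of a global effective Cartier divisor of order ≤ 1
everywhere, Γ has a resolution (ORDER-ONE PENCILS RESOLVE; restriction of MR; necessity kernel
`splitOrderOneResolve_of_summit`; mechanism: replay embedded resolution of V(h̄) ⊂ H one dimension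
down + binomial descent). [difficulty: open-problem] (why it might fail: cannot fail unless S fails;
as a TARGET it is embedded resolution of hypersurfaces one dimension down in substance (family u·x =
h(y)): closed mod CossartJannsenSaito2020 for dim Y ≤ 4 (rung SplitOrderOneResolveDimFour), open
from dim Y = 5 (embedded threefolds, Hauser–Perlega 2024 p. 2).) [CossartJannsenSaito2020,
doi:10.4171/prims/60-4-5, Kollar2007, Kato1994]
#4 RegularRoofs (crux) — for every prime p, field k of char p and integral separated finite-type X/k
there are a reduced Γ, a regular separated finite-type Y/k, a proper birational a : Γ ⟶ X and a
separated finite-type birational b : Γ ⟶ Y (RR, Dominance stmt-ResolutionOfSingularities-24573 BY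
SIGNATURE; certified WEAKER there by the separating class of sandwiched X; necessity kernel
`regularRoofs_of_summit`). [difficulty: open-problem] (why it might fail: cannot fail unless S fails
(kernel); as a TARGET it is «nonsingular models of function fields of dim ≥ 4» (Zariski's models
half, census A7 RegModel in roof form) — open, IDEA-NEEDED (abstract Zariski patching or a
non-valuative model mechanism).) [Cutkosky2009, Piltant2013, CossartPiltant2019]
#9 PencilReduction (support) — MR for pencil blow-ups (blow-ups of regular separated finite-type Y
along ideal sheaves locally generated by two sections, reduced and birational) implies MR verbatim
(Dominance.SandwichedResolve). COSTUME(cite): restrict to the closure of the iso locus,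
Nagata-compactify b, Chow + Hartshorne1977 II.7.17 (a projective birational morphism onto a
quasi-projective regular Y is the blow-up of a coherent ideal), induction on the number of
generators (principalize all but one generator first; the transform is then two-generated),
transport by `Scheme.HasResolution.of_isBirational` / `.restrict`. [difficulty: L] [Hartshorne1977,
Conrad2007, Cutkosky2009]
#9 PencilResolve (support) — MR restricted to pencil blow-ups (the EQUIV node: kernel
`pencilResolve_iff : PencilResolve ↔ SplitOrderReduction ∧ SplitOrderOneResolve`). To be filed as
`aside` (not staffed; BC6: not consumed by closes except through PencilReduction's hypothesis, which
closes builds from the two cruxes). [difficulty: open-problem] [Hartshorne1977, Kollar2007]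
#9 SplitOrderOneResolveDimFour (support) — SplitOrderOneResolve for Y of topological Krull dimension
≤ 4 — the RUNG, ATTACKABLE and closed mod library: `CossartJannsenSaito2020Embedded` (embedded
resolution of the reduced surface V(h̄) in the regular threefold H by blow-ups in regular centres
over it, total transform snc) + the replay lemma (strict transform of u·x = h under Bl_C is u·x' =
e^(b−1)·h') + binomial descent (blow up H ∩ E_i); fourfolds outside CossartPiltant2019, containing
every u·x = h(y₁,y₂,y₃) and the m = 1 slice of Dominance R1. To be filed as `aside`; necessity
kernel `splitOrderOneResolveDimFour_of_summit`. [difficulty: L] [CossartJannsenSaito2020, Kato1994,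
CossartPiltant2019]
#9 LocalOrderOneResolve (support) — lens-3's generic piece PR¹ at scheme level (H-free): pencil
blow-ups whose ideal has order ≤ 1 at every point (BGMW idealOrder; = PencilOrderLEOne) resolve.
Merge interface: implies SplitOrderOneResolve (kernel), equals it modulo Globalisation (kernel); its
dim-4 rung needs CJS functoriality + a gluing port. To be filed as `aside`; necessity
`localOrderOneResolve_of_summit`. [difficulty: open-problem] [Kollar2007,
BierstoneGrigorievMilmanWlodarczyk2011]
#9 LocalOrderReduction (support) — lens-3's residual ORD at scheme level: every reduced pencil
blow-up is dominated properly birationally by a pencil blow-up of order ≤ 1 everywhere over another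
regular base. Merge interface: SplitOrderReduction ⟺ LocalOrderReduction ∧ Globalisation (kernel).
To be filed as `aside`; necessity `localOrderReduction_of_summit`. [difficulty: open-problem]
[Kollar2007, CossartPiltant2019]
#9 Globalisation (support) — GLOBALISATION OF MAXIMAL CONTACT — every reduced pencil blow-up of
order ≤ 1 everywhere is dominated properly birationally by a globally split order-one pencil blow-up
over another regular base; the typed content of lens-3's test T-PR¹-glob and the exact difference
between the two nodes (local ≠ global as hypotheses: Pic obstruction, NOTES §F6). To be filed as
`aside`; necessity `globalisation_of_summit`. [difficulty: open-problem] [CossartJannsenSaito2020,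
Kollar2007]
#9 PencilResolveDimFour (support) — PR₄ — pencil blow-ups over a regular separated finite-type Y/k
with topological Krull dimension ≤ 4 resolve (the dimension-4 pencil residual; the pencil part of
Dominance.SandwichedResolveDimFour stmt-24575). To be filed as `aside`. NECESSARY (kernel
`pencilResolveDimFour_of_summit`); KERNEL `pencilResolveDimFour_iff_tame_and_wild`. [difficulty:
open-problem] [CossartPiltant2019, Cutkosky2009]
#9 TameOrderPencilResolveDimFour (support) — Tame₄ (gen-3 rung) — pencil blow-ups over a regular Y/k
of dimension ≤ 4 whose ideal has order < p at EVERY point resolve. To be filed as `aside`. NECESSARY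
(kernel `tameOrderPencilResolveDimFour_of_summit`); contains SplitOrderOneResolveDimFour (kernel
`splitOrderOneResolveDimFour_of_tame`). Mechanism: hereditary maximal contact below the
characteristic puts the coefficient marked ideal on a regular threefold (Kollar2007 §3), then
marked-ideal resolution on threefolds in char p (KawanoueMatsuki2016 local algorithm;
CossartJannsenSaito2020 / BenitoVillamayor2012 for 2-dimensional pieces) and the order-one rung.
ATTACKABLE mod ports with ONE UNDECIDED seam (a GLOBAL marked-ideal theorem on regular threefolds in
char p; z-generality over finite residue fields). [difficulty: XL] [Kollar2007, arXiv:1205.4556,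
CossartJannsenSaito2020, doi:10.1112/s0010437x1200084x]
#9 WildOrderPencilResolveDimFour (support) — Wild₄ (gen-3 located residual) — pencil blow-ups over a
regular Y/k of dimension ≤ 4 whose ideal has order ≥ p at SOME point resolve. To be filed as
`aside`. NECESSARY (kernel `wildOrderPencilResolveDimFour_of_summit`); with Tame₄ it is exactly PR₄
(kernel). IDEA-NEEDED: every rational specimen of the cell's bed lies here (orders ≥ p, initial
forms p-th powers, no maximal contact). [difficulty: open-problem] [CossartPiltant2019,
arXiv:1205.4556, doi:10.4310/ajm.2011.v15.n3.a3]
#9 PencilsSufficeK (support) — lens-3's kernel Theorem A «pencils suffice», K-level with predicates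
inlined: elimination of indeterminacy of single rational functions over regular proper models (PR_K)
implies that every projective model of a function field having some regular proper model is resolved
(DOM_K). To be filed as `aside`; proved in HOME/decomp-res-lens-3/PencilDomination.lean
(`regularDomination_of_pencilResolve`), to land post-birth as a Theorems file proving this item by
name. COSTUME(kernel). [difficulty: L] [Hartshorne1977, Conrad2007]
#9 DominationPencilsK (support) — lens-3's kernel Theorem C, the converse DOM_K ⟹ PR_K (Chow
`ChowLemmaIntegral_holds` + the graph model Γ_f ⊆ R ×ₖ ℙ¹), making PR_K ⟺ DOM_K the node's certified
K-level EQUIV. To be filed as `aside`; proved in lens-3's file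
(`pencilResolve_of_regularDomination`). COSTUME(kernel). [difficulty: L] [Hartshorne1977,
Conrad2007]

TWO-LAYER PLAN. SplitOrderOneResolve ⇐ (replay lemma: strict transform of a split order-one pencil
blow-up under a regular centre C ⊂ V(x, h̄) is again split
order-one, with h̄ ↦ marking-1 controlled transform) ∧ (embedded resolution of hypersurfaces in
regular (n−1)-folds by regular centres over the
hypersurface) ∧ (binomial descent u·x = y^a by blowing up H ∩ E_i) — the middle child is the open
one from n − 1 = 4; the rung
SplitOrderOneResolveDimFour is the same split with the middle child =
`CossartJannsenSaito2020Embedded` (provable-now modulo porting, size L).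
SplitOrderReduction is NOT split (IDEA-NEEDED): foreseen children «order reduction of the marked
pencil ideal ((g,h), 2) on regular n-folds» ∧
«globalisation of the order-one hypersurface», both open in dim ≥ 4.

GEN 3: PencilResolveDimFour ⇐ TameOrderPencilResolveDimFour ∧ WildOrderPencilResolveDimFour is
KERNEL (exhaustion by `by_cases` on the pointwise
order). Foreseen split of Tame₄ (not filed; asides are not split): (hereditary maximal contact for
marked ideals (I, b), b < p, on regular
fourfolds: coefficient marked ideal on a regular threefold — char-0 transplant) ∧ (GLOBAL resolution
of marked ideals on regular threefolds in
char p — the seam) ∧ (SplitOrderOneResolveDimFour).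

KILL CRITERIA. No crux is refutable without refuting the summit (all four are kernel consequences:
`*_of_summit` in the draft). The node is retired as COSTUME if
someone proves SplitOrderOneResolve → SandwichedResolve cheaply (then O1 ≡ MR; the dim-4 separating
class says this needs WPRIN₄) or SplitOrderReduction
→ SandwichedResolve (then OR ≡ MR; needs embedded resolution of hypersurfaces in all dimensions); it
is superseded on the O1 side if embedded
resolution of hypersurfaces lands in all dimensions (then only SplitOrderReduction and RegularRoofs
remain, the honest residuals «order reduction» and
«models»).
 GEN 3: Tame₄ is retired as costume if Tame₄ → PencilResolveDimFour closes cheaply (probe FAILED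
here), and loses «attackable» if
test T-tame-lit finds that no global marked-ideal theorem on threefolds in char p exists or can be
assembled from KawanoueMatsuki2016 +
BenitoVillamayor2012 (then the seam is a genuine open item «GlobalMarkedIdealDimThree»,
INSTRUMENTABLE → IDEA-NEEDED).

NOT DECOMPOSED YET. SplitOrderReduction (the wild core: order ≥ 2 base points, where every member of
the pencil is singular and no maximal-contact hypersurface need exist —
Narasimhan/Cossart–Piltant specimens enter through split pencils (x₁^p, h) and mixed pencils (z^p +
h₁, h₂)); RegularRoofs (Dominance's banked
target). SplitOrderOneResolve above dimension 4 = embedded resolution of threefolds and higher, not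
decomposed.
 GEN 3: WildOrderPencilResolveDimFour (order ≥ p base points on
fourfolds: the located dim-4 core of the cell after lenses 2/3/5/6) is not decomposed — IDEA-NEEDED.

CHEAPEST FALSIFIER. Lean probes (g3/bc/ProbeC.lean): 13 implications × {aesop, exact?} = 26 genuine
failures — Tame₄ → S / MR / PR₄, Wild₄ → S / MR / PR₄, PR₄ → MR,
Tame₄ ↔ Wild₄, and the gen-2 ones SplitOrderReduction / SplitOrderOneResolve → MR / S; a success
retires that piece as costume; converses are
kernels. Desk test T-tame-lit (≈ 1 h): is a GLOBAL marked-ideal / Rees-algebra resolution theorem on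
regular threefolds over perfect fields of
char p in print (KawanoueMatsuki2016 announce it; BenitoVillamayor2012 strong monomial case)? NO ⇒
Tame₄'s seam becomes an open item. Kit test
T-tame-bed (≤ 0.1 core-h, census rr_scan): ord_P(g, h) vs p on the 34 R1/R2 charts — prediction b ≥
p throughout (Wild₄ holds the bed). Gen-2 tests
T-O1-spec (replay lemma on u·x = y² − z³ under Bl_{V(x,y,z)}) and T-MR-lin unchanged.

NUMBERS. dim Y ≤ 3: everything known (CossartPiltant2019). dim Y = 4: O1 closed mod
CossartJannsenSaito2020 (rung), OR₄ ⟺ WPRIN₄ mod the rung (open,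
Cutkosky2009 p. 3). dim Y = 5: O1 open (embedded threefolds). Negatives index at filing: 5 refuted
statements (HomologicalConductor aside,
ShadowGame ×2, EscapeRate, DefectlessFrames), none on the order/pencil axis.
 GEN 3: Tame₄ ⊇ SO1R₄ ⊇ R1(m=1); inputs of Tame₄: Kollar2007 §3 (b < p ⇒ b!
invertible), KawanoueMatsuki2016 (dim-3 LOCAL marked-ideal algorithm, k = k̄; dim ≥ 4 open, p. 2),
CJS2020/BV2012 (dim-2 subschemes); items: 15
(3 crux, 1 support, 10 aside, 1 assembly); probes 13/13 FAIL.

DEFINITION REQUESTS. None: `IsBlowup`, `Scheme.IdealSheafData`, `idealOrder` (BGMW order,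
MarkedIdeals.lean), `Scheme.IsRegular`, `IsBirational`,
`Scheme.HasResolution`, `topologicalKrullDim`, `IsRegularRing` exist; the pencil / split-order-one
clauses are inlined.

Novelty: Searches (2026-08-30): GEN 3 — rg over Summits/…/Theses for "idealOrder.*<|order < p|tame
order|TameOrder" (hits: AbsoluteConfinement TameMultiplicity = multiplicity of hypersurface GERMS <
p, not pencil order; none other); lit search --hybrid "maximal contact exists when order less than
characteristic coefficient ideal" (kollar2007 ch.3 pp.155–173, char 0); lit read arxiv:1205.4556
pp.1–3 (KawanoueMatsuki2016: IFP algorithm dim 3 local, «dimension 4 or above remains open», global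
version unpublished); lit read paper:hauser2024 p.2; lit search "Benito Villamayor monoidal
transformations Rees algebras positive characteristic" (doi:10.1112/s0010437x1200084x,
arXiv:1004.1803 abstract: strong monomial case); lit galaxy search "tau invariant|maximal
contact|order less than p" --star pdf (no statement of Tame₄). GEN 2 — rg over Summits/…/Theses for
"idealOrder|maximal contact|OrderOne|order one" (hits only MarkedTransfer HOR / WeightedThesis
marked-ideal cruxes and NarasimhanMaximalContact as obstruction; no order-one or pencil-order item);
lit search --hybrid "embedded resolution of threefolds in positive characteristic is open" (6 docs;
hit paper:hauser2024 p.2); lit search --hybrid "hypersurface of maximal contact order one blow up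
regular hypersurface containing the center strict transform" (5 docs: kollar2007 pp.155/171/173,
cossart–jannsen–saito2020 p.172, herrmann–orbanz1988 — char-0 maximal contact and permissibility, no
sandwiched/pencil statement); lit papers --grep Cossa  [refs: 10.1112/s0010437x1200084x, 1205.4556, 1004.1803, math/0010002, arxiv:1205.4556, paper:hauser2024, doi:10.1112/s0010437x1200084x, KawanoueMatsuki2016, Kollar2007]

Barriers (technique_class: birational-geometry, sandwiched, maximal-contact, tame-order): - technique_class: birational-geometry, sandwiched, maximal-contact, tame-order
- Literature.Barriers.ResolutionOfSingularities.NarasimhanMaximalContactNarrow: GEN 3 — OUTSIDE for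
Tame₄ (the Narasimhan specimens have order = p at the bad point; maximal contact is used only at
orders b < p where b·c ≠ 0 gives heredity), INSIDE for Wild₄. GEN 2 — OUTSIDE for
SplitOrderOneResolve and its rung — maximal contact is used only at order 1 < 2 ≤ p, where a member
x ∉ 𝔪² of the pencil is a regular hypersurface containing the base locus and all its permissible
transforms (replay lemma); INSIDE for SplitOrderReduction's substance (order ≥ p base points), which
the node types as existence and does not claim to evade; the bet is that pencil structure (two
generators, a birational morphism to a regular Y) is extra input.
- Literature.Barriers.ResolutionOfSingularities.Narasimhan1983_noSmoothHypersurfaceThroughTopLocus: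
same placement as NarasimhanMaximalContactNarrow — a smooth hypersurface through the top locus is
asked only where the order is 1 (gen 2: a pencil member x ∉ 𝔪², replay lemma) or b < p (gen 3,
Tame₄: Tschirnhausen via Diff^(b−1), (b−1)! invertible, hereditary); the Narasimhan specimens (order
p at the bad point) live in Wild₄ / SplitOrderReduction, which the node locates as the residual and
does not claim to evade.
- Literature.Barriers.ResolutionOfSingularities.hauserPerlega_mohProofBoundFails: GEN 3 — OUTSIDE
for TameOrderPencilResolveDimFour (the residual-order jump of Moh

History (route lifecycle, newest last):
- 2026-08-30T04:17:03Z · rev 1: informal re-worded for TameOrderPencilResolveDimFour (planner-decomp-res-writer-1-g2-0)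
- 2026-08-30T04:48:54Z · rev 3: informal re-worded for Globalisation (planner-decomp-res-writer-1-g2-0)
- 2026-08-30T05:19:59Z · rev 4: informal re-worded for Globalisation (planner-decomp-res-writer-1-g3-0)
- 2026-08-30T05:20:13Z · rev 5: informal re-worded for SplitOrderOneResolveDimFour (planner-decomp-res-writer-1-g3-0)
- 2026-08-30T05:20:26Z · rev 6: informal re-worded for LocalOrderOneResolve (planner-decomp-res-writer-1-g3-0)
- 2026-08-30T05:41:48Z · rev 7: informal re-worded for Globalisation, TameOrderPencilResolveDimFour, ContactResolveDimFourOne, ContactResolveDimFourTwo (planner-decomp-res-writer-1-g3-0)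

sub-problem: ResolutionOfSingularities · status: draft · opened planner-decomp-res-writer-1-g0-0 2026-08-30T03:56:01Z · rev 7 · ledger route-ResolutionOfSingularities-OrderCut
GENERATED by the gate from the ledger (D-0016/17). Provers cite these decls: `theorem foo : Summit.ResolutionOfSingularities.ResolutionOfSingularities.Theses.OrderCut.<Decl> := …` in Summits/ResolutionOfSingularities/ResolutionOfSingularities/Theorems/<Name>.lean.
-/

namespace Summit.ResolutionOfSingularities.ResolutionOfSingularities.Theses.OrderCut

open scoped BigOperators Topology Manifold Classical MeasureTheory ProbabilityTheory Matrix InnerProductSpace ComplexConjugate ContinuousMap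
open Filter Set Function TopologicalSpace MeasureTheory

attribute [summit_statement] _root_.ResolutionOfSingularities

/-- item stmt-ResolutionOfSingularities-27127 · crux · rank 2 · open · by planner
why it might fail: cannot fail unless S fails (kernel consequence); as a TARGET it carries wild order reduction one dimension down (split pencils (x₁^p, h); mixed pencils give z^p + F(x, w)) — IDEA-NEEDED; certified weaker than MR only by the separating class of order-one inputs.
sources: Kollar2007, BierstoneGrigorievMilmanWlodarczyk2011, CossartPiltant2019, doi:10.4310/ajm.2011.v15.n3.a3
[crux] for every prime p, field k of char p, regular separated finite-type Y/k and reduced Γ with a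
separated finite-type birational b : Γ ⟶ Y that is the blow-up of an ideal sheaf locally generated
by two sections, there are a regular separated finite-type Y₁/k, a reduced Γ₁ with a separated
finite-type birational b₁ : Γ₁ ⟶ Y₁ that is the blow-up of an ideal sheaf locally (x, h) with (x)
locally the ideal of a global effective Cartier divisor H of order ≤ 1 at every point (a regular
hypersurface), and a proper birational π : Γ₁ ⟶ Γ (ORDER REDUCTION for pencils; EXISTENCE; the
node's residual; necessity kernel `splitOrderReduction_of_summit`). [difficulty: open-problem] -/
@[route_item "route-ResolutionOfSingularities-OrderCut", crux]
def SplitOrderReduction : Prop :=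
  ∀ p : ℕ, p.Prime → ∀ (k : Type) [Field k] [CharP k p] (Y : AlgebraicGeometry.Scheme.{0}) (g : Y ⟶ AlgebraicGeometry.Spec (.of k)), AlgebraicGeometry.IsSeparated g → AlgebraicGeometry.LocallyOfFiniteType g → AlgebraicGeometry.QuasiCompact g → Literature.AlgebraicGeometry.Resolution.Scheme.IsRegular Y → ∀ (Γ : AlgebraicGeometry.Scheme.{0}) (b : Γ ⟶ Y), AlgebraicGeometry.IsSeparated b → AlgebraicGeometry.LocallyOfFiniteType b → AlgebraicGeometry.QuasiCompact b → Literature.AlgebraicGeometry.Resolution.IsBirational b → AlgebraicGeometry.IsReduced Γ → (∃ I : Y.IdealSheafData, Literature.AlgebraicGeometry.Resolution.IsBlowup b I ∧ ∀ y : Y, ∃ U : Y.affineOpens, y ∈ (U : Y.Opens) ∧ ∃ x h : Y.presheaf.obj (Opposite.op (U : Y.Opens)), I.ideal U = Ideal.span {x, h}) → ∃ (Y₁ Γ₁ : AlgebraicGeometry.Scheme.{0}) (g₁ : Y₁ ⟶ AlgebraicGeometry.Spec (.of k)) (b₁ : Γ₁ ⟶ Y₁) (π : Γ₁ ⟶ Γ),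 AlgebraicGeometry.IsSeparated g₁ ∧ AlgebraicGeometry.LocallyOfFiniteType g₁ ∧ AlgebraicGeometry.QuasiCompact g₁ ∧ Literature.AlgebraicGeometry.Resolution.Scheme.IsRegular Y₁ ∧ AlgebraicGeometry.IsSeparated b₁ ∧ AlgebraicGeometry.LocallyOfFiniteType b₁ ∧ AlgebraicGeometry.QuasiCompact b₁ ∧ Literature.AlgebraicGeometry.Resolution.IsBirational b₁ ∧ AlgebraicGeometry.IsReduced Γ₁ ∧ (∃ I H : Y₁.IdealSheafData, Literature.AlgebraicGeometry.Resolution.IsBlowup b₁ I ∧ ∀ y : Y₁, ∃ U : Y₁.affineOpens, y ∈ (U : Y₁.Opens) ∧ Literature.AlgebraicGeometry.Resolution.idealOrder H y ≤ 1 ∧ ∃ x h : Y₁.presheaf.obj (Opposite.op (U : Y₁.Opens)), H.ideal U = Ideal.span {x} ∧ I.ideal U = Ideal.span {x, h}) ∧ AlgebraicGeometry.IsProper π ∧ Literature.AlgebraicGeometry.Resolution.IsBirational π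

/-- item stmt-ResolutionOfSingularities-27128 · crux · rank 3 · open · by planner
why it might fail: cannot fail unless S fails; as a TARGET it is embedded resolution of hypersurfaces one dimension down in substance (family u·x = h(y)): closed mod CossartJannsenSaito2020 for dim Y ≤ 4 (rung SplitOrderOneResolveDimFour), open from dim Y = 5 (embedded threefolds, Hauser–Perlega 2024 p. 2).
sources: CossartJannsenSaito2020, doi:10.4171/prims/60-4-5, Kollar2007, Kato1994
[crux] for every prime p, field k of char p, regular separated finite-type Y/k and reduced Γ with a
separated finite-type birational b : Γ ⟶ Y that is the blow-up of an ideal sheaf locally (x, h) with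
(x) locally the ideal of a global effective Cartier divisor of order ≤ 1 everywhere, Γ has a
resolution (ORDER-ONE PENCILS RESOLVE; restriction of MR; necessity kernel
`splitOrderOneResolve_of_summit`; mechanism: replay embedded resolution of V(h̄) ⊂ H one dimension
down + binomial descent). [difficulty: open-problem] -/
@[route_item "route-ResolutionOfSingularities-OrderCut", crux]
def SplitOrderOneResolve : Prop :=
  ∀ p : ℕ, p.Prime → ∀ (k : Type) [Field k] [CharP k p] (Y : AlgebraicGeometry.Scheme.{0}) (g : Y ⟶ AlgebraicGeometry.Spec (.of k)), AlgebraicGeometry.IsSeparated g → AlgebraicGeometry.LocallyOfFiniteType g → AlgebraicGeometry.QuasiCompact g → Literature.AlgebraicGeometry.Resolution.Scheme.IsRegular Y → ∀ (Γ : AlgebraicGeometry.Scheme.{0}) (b : Γ ⟶ Y), AlgebraicGeometry.IsSeparated b → AlgebraicGeometry.LocallyOfFiniteType b → AlgebraicGeometry.QuasiCompact b → Literature.AlgebraicGeometry.Resolution.IsBirational b → AlgebraicGeometry.IsReduced Γ → (∃ I H : Y.IdealSheafData, Literature.AlgebraicGeometry.Resolution.IsBlowup b I ∧ ∀ y : Y,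 ∃ U : Y.affineOpens, y ∈ (U : Y.Opens) ∧ Literature.AlgebraicGeometry.Resolution.idealOrder H y ≤ 1 ∧ ∃ x h : Y.presheaf.obj (Opposite.op (U : Y.Opens)), H.ideal U = Ideal.span {x} ∧ I.ideal U = Ideal.span {x, h}) → Literature.AlgebraicGeometry.Resolution.Scheme.HasResolution Γ

/-- item stmt-ResolutionOfSingularities-24573 · crux · rank 4 · open · by planner
why it might fail: cannot fail unless S fails (kernel); as a TARGET it is «nonsingular models of function fields of dim ≥ 4» (Zariski's models half, census A7 RegModel in roof form) — open, IDEA-NEEDED (abstract Zariski patching or a non-valuative model mechanism).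
sources: Cutkosky2009, Piltant2013, CossartPiltant2019
[crux] for every prime p, field k of characteristic p and integral separated finite-type k-scheme X
there are a reduced Γ, a regular separated finite-type k-scheme Y, a proper birational a : Γ ⟶ X and
a separated finite-type birational b : Γ ⟶ Y (RR: regular models in roof form; necessity kernel
`regularRoofs_of_summit`; bracketed LU_abs ⟸ RR ⟸ S for proper X). BOOKING (critic row 6; tribunal
02:36Z): the ATTACKED conjunct — NECESSARY ✓ · WEAKER CERTIFIED by a separating CLASS (RR is a
theorem on every sandwiched X — lens kernel `roof_of_sandwiched` — and on every X whose function
field has a regular proper model, by graph closure + Nagata: all rational X, every pencil graph {u·g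
= h}, Bl_I 𝔸⁴, the Cossart–Piltant fourfold — a class on which S is OPEN from dimension 4) ·
junk-free · IDEA-NEEDED (open core = regular proper models of function fields of transcendence
degree ≥ 4 in char p; no lever in print beyond local uniformization + patching, Cutkosky2009 p. 3).
In ProperModel language RR(proper X) ⟺ `ProperModel.RegModel` (tree A7 half); its typed bisection
RegModel ⟺ PialtModels ∧ HeightOneDescent is kernel
(`Theorems.QuotientModelsMinimalHeight.regModel_iff`, p760563) and is rou -/
@[route_item "route-ResolutionOfSingularities-OrderCut", crux]
def RegularRoofs : Prop :=
  ∀ p : ℕ, p.Prime → ∀ (k : Type) [Field k] [CharP k p] (X : AlgebraicGeometry.Scheme.{0}) (f : X ⟶ AlgebraicGeometry.Spec (.of k)), AlgebraicGeometry.IsSeparated f → AlgebraicGeometry.LocallyOfFiniteType f → AlgebraicGeometry.QuasiCompact f → AlgebraicGeometry.IsIntegral X → ∃ (Γ Y : AlgebraicGeometry.Scheme.{0}) (a : Γ ⟶ X) (b : Γ ⟶ Y) (g : Y ⟶ AlgebraicGeometry.Spec (.of k)), AlgebraicGeometry.IsSeparated g ∧ AlgebraicGeometry.LocallyOfFiniteType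 g ∧ AlgebraicGeometry.QuasiCompact g ∧ Literature.AlgebraicGeometry.Resolution.Scheme.IsRegular Y ∧ AlgebraicGeometry.IsReduced Γ ∧ AlgebraicGeometry.IsProper a ∧ Literature.AlgebraicGeometry.Resolution.IsBirational a ∧ AlgebraicGeometry.IsSeparated b ∧ AlgebraicGeometry.LocallyOfFiniteType b ∧ AlgebraicGeometry.QuasiCompact b ∧ Literature.AlgebraicGeometry.Resolution.IsBirational b

/-- item stmt-ResolutionOfSingularities-27129 · support · rank 9 · open · by planner
sources: Hartshorne1977, Conrad2007, Cutkosky2009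
[support] MR for pencil blow-ups (blow-ups of regular separated finite-type Y along ideal sheaves
locally generated by two sections, reduced and birational) implies MR verbatim
(Dominance.SandwichedResolve). COSTUME(cite): restrict to the closure of the iso locus,
Nagata-compactify b, Chow + Hartshorne1977 II.7.17 (a projective birational morphism onto a
quasi-projective regular Y is the blow-up of a coherent ideal), induction on the number of
generators (principalize all but one generator first; the transform is then two-generated),
transport by `Scheme.HasResolution.of_isBirational` / `.restrict`. [difficulty: L] -/
@[route_item "route-ResolutionOfSingularities-OrderCut", crux]
def PencilReduction : Prop :=
  (∀ p : ℕ, p.Prime → ∀ (k : Type) [Field k] [CharP k p] (Y : AlgebraicGeometry.Scheme.{0}) (g : Y ⟶ AlgebraicGeometry.Spec (.of k)), AlgebraicGeometry.IsSeparated g → AlgebraicGeometry.LocallyOfFiniteType g → AlgebraicGeometry.QuasiCompact g → Literature.AlgebraicGeometry.Resolution.Scheme.IsRegular Y → ∀ (Γ : AlgebraicGeometry.Scheme.{0}) (b : Γ ⟶ Y), AlgebraicGeometry.IsSeparated b → AlgebraicGeometry.LocallyOfFiniteType b → AlgebraicGeometry.QuasiCompact b → Literature.AlgebraicGeometry.Resolution.IsBirational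 b → AlgebraicGeometry.IsReduced Γ → (∃ I : Y.IdealSheafData, Literature.AlgebraicGeometry.Resolution.IsBlowup b I ∧ ∀ y : Y, ∃ U : Y.affineOpens, y ∈ (U : Y.Opens) ∧ ∃ x h : Y.presheaf.obj (Opposite.op (U : Y.Opens)), I.ideal U = Ideal.span {x, h}) → Literature.AlgebraicGeometry.Resolution.Scheme.HasResolution Γ) → ∀ p : ℕ, p.Prime → ∀ (k : Type) [Field k] [CharP k p] (Y : AlgebraicGeometry.Scheme.{0}) (g : Y ⟶ AlgebraicGeometry.Spec (.of k)), AlgebraicGeometry.IsSeparated g → AlgebraicGeometry.LocallyOfFiniteType g → AlgebraicGeometry.QuasiCompact g → Literature.AlgebraicGeometry.Resolution.Scheme.IsRegular Y → ∀ (Γ : AlgebraicGeometry.Scheme.{0}) (b : Γ ⟶ Y), AlgebraicGeometry.IsSeparated b → AlgebraicGeometry.LocallyOfFiniteType b → AlgebraicGeometry.QuasiCompact b → Literature.AlgebraicGeometry.Resolution.IsBirational b → AlgebraicGeometry.IsReduced Γ → Literature.AlgebraicGeometry.Resolution.Scheme.HasResolution Γ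

/-- item stmt-ResolutionOfSingularities-27130 · aside · rank 9 · open · by planner
sources: Hartshorne1977, Kollar2007
[support] MR restricted to pencil blow-ups (the EQUIV node: kernel `pencilResolve_iff :
PencilResolve ↔ SplitOrderReduction ∧ SplitOrderOneResolve`). To be filed as `aside` (not staffed;
BC6: not consumed by closes except through PencilReduction's hypothesis, which closes builds from
the two cruxes). [difficulty: open-problem] -/
@[route_item "route-ResolutionOfSingularities-OrderCut", crux]
def PencilResolve : Prop :=
  ∀ p : ℕ, p.Prime → ∀ (k : Type) [Field k] [CharP k p] (Y : AlgebraicGeometry.Scheme.{0}) (g : Y ⟶ AlgebraicGeometry.Spec (.of k)), AlgebraicGeometry.IsSeparated g → AlgebraicGeometry.LocallyOfFiniteType g → AlgebraicGeometry.QuasiCompact g → Literature.AlgebraicGeometry.Resolution.Scheme.IsRegular Y → ∀ (Γ : AlgebraicGeometry.Scheme.{0}) (b : Γ ⟶ Y), AlgebraicGeometry.IsSeparated b → AlgebraicGeometry.LocallyOfFiniteType b → AlgebraicGeometry.QuasiCompact b → Literature.AlgebraicGeometry.Resolution.IsBirational b → AlgebraicGeometry.IsReduced Γ → (∃ I : Y.IdealSheafData,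 Literature.AlgebraicGeometry.Resolution.IsBlowup b I ∧ ∀ y : Y, ∃ U : Y.affineOpens, y ∈ (U : Y.Opens) ∧ ∃ x h : Y.presheaf.obj (Opposite.op (U : Y.Opens)), I.ideal U = Ideal.span {x, h}) → Literature.AlgebraicGeometry.Resolution.Scheme.HasResolution Γ

/-- item stmt-ResolutionOfSingularities-27131 · aside · rank 9 · open · by planner
sources: CossartJannsenSaito2020, Kato1994, CossartPiltant2019
[aside · ATTACKABLE · CLOSED-MOD-LIBRARY (library in tree) · ⟸ 28008
MaxContactCut.LocalOrderOneResolveDimFour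
(OrderCutIntrinsicCentres.splitOrderOneResolveDimFour_of_localOrderOneResolveDimFour, p762285;
CRITIC-LEDGER row 32, 2026-08-30T05:13:17Z) — attack it THROUGH 28008, the cell's best prover
target] SplitOrderOneResolve for Y of topological Krull dimension ≤ 4 — the RUNG: tree facts
CossartJannsenSaito2020Embedded{,Sequence,SequenceBoundary} (embedded resolution of the reduced
surface V(x, h)_red in the regular ambient, total transform snc) + replay lemma (strict transform of
u·x = h under Bl_C is u·x′ = e^(b−1)·h′) + elementary monomial end game. «+ Kato1994» DROPPED
(critic row 32: the end state h̄_n = unit·monomial on the regular threefold H_n is finished by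
blowing up V(x_n, g); no log-regular input). Fourfolds outside CossartPiltant2019, containing every
u·x = h(y₁,y₂,y₃) and the m = 1 slice of Dominance R1. Necessity
splitOrderOneResolveDimFour_of_summit. [difficulty: L] -/
@[route_item "route-ResolutionOfSingularities-OrderCut"]
def SplitOrderOneResolveDimFour : Prop :=
  ∀ p : ℕ, p.Prime → ∀ (k : Type) [Field k] [CharP k p] (Y : AlgebraicGeometry.Scheme.{0}) (g : Y ⟶ AlgebraicGeometry.Spec (.of k)), AlgebraicGeometry.IsSeparated g → AlgebraicGeometry.LocallyOfFiniteType g → AlgebraicGeometry.QuasiCompact g → Literature.AlgebraicGeometry.Resolution.Scheme.IsRegular Y → topologicalKrullDim Y ≤ 4 → ∀ (Γ : AlgebraicGeometry.Scheme.{0}) (b : Γ ⟶ Y), AlgebraicGeometry.IsSeparated b → AlgebraicGeometry.LocallyOfFiniteType b → AlgebraicGeometry.QuasiCompact b → Literature.AlgebraicGeometry.Resolution.IsBirational b → AlgebraicGeometry.IsReduced Γ → (∃ I H : Y.IdealSheafData, Literature.AlgebraicGeometry.Resolution.IsBlowup b I ∧ ∀ y : Y, ∃ U : Y.affineOpens,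 y ∈ (U : Y.Opens) ∧ Literature.AlgebraicGeometry.Resolution.idealOrder H y ≤ 1 ∧ ∃ x h : Y.presheaf.obj (Opposite.op (U : Y.Opens)), H.ideal U = Ideal.span {x} ∧ I.ideal U = Ideal.span {x, h}) → Literature.AlgebraicGeometry.Resolution.Scheme.HasResolution Γ

/-- item stmt-ResolutionOfSingularities-27132 · aside · rank 9 · open · by planner
sources: Kollar2007, BierstoneGrigorievMilmanWlodarczyk2011
[OrderCut: aside · MaxContactCut: crux rank 4 · UNDECIDED across n (stays crux) · LADDER
(CRITIC-LEDGER row 32, 2026-08-30T05:13:17Z; lens-3 g5 IntrinsicCentres): rung n ⟺ canonical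
embedded resolution (with boundary, CJS (F2)) of reduced (n−2)-folds in a regular n-fold suffices; n
= 4 rung = 28008 CLOSED-MOD-LIBRARY with the library in tree (CossartJannsenSaito2020Embedded*) =
best prover target; ceiling CJS dim ≤ 2, i.e. n ≤ 4; n = 5 needs embedded resolution of reduced
threefolds in regular 5-folds (open)] lens-3's generic piece PR¹ at scheme level (H-free): pencil
blow-ups whose ideal has order ≤ 1 at every point (BGMW idealOrder; = PencilOrderLEOne) resolve.
Merge interface (Theorems/OrderCutIntrinsicCentres, p762285): ⟹ SplitOrderOneResolve 27128;
Globalisation 27134 ⟸ THIS (identity trick) and EXACT 27132 ⟺ 27128 ∧ 27134 — Globalisation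
ELIMINATED as an independent binder; SplitOrderReduction 27127 ⟸ LocalOrderReduction 27133 ∧ THIS;
ROOT ⟺ RR ∧ PencilReduction ∧ 27133 ∧ THIS (summit_iff_local). Necessity
localOrderOneResolve_of_summit. [difficulty: open for n ≥ 5; L for n = 4 via 28008] -/
@[route_item "route-ResolutionOfSingularities-OrderCut", crux]
def LocalOrderOneResolve : Prop :=
  ∀ p : ℕ, p.Prime → ∀ (k : Type) [Field k] [CharP k p] (Y : AlgebraicGeometry.Scheme.{0}) (g : Y ⟶ AlgebraicGeometry.Spec (.of k)), AlgebraicGeometry.IsSeparated g → AlgebraicGeometry.LocallyOfFiniteType g → AlgebraicGeometry.QuasiCompact g → Literature.AlgebraicGeometry.Resolution.Scheme.IsRegular Y → ∀ (Γ : AlgebraicGeometry.Scheme.{0}) (b : Γ ⟶ Y), AlgebraicGeometry.IsSeparated b → AlgebraicGeometry.LocallyOfFiniteType b → AlgebraicGeometry.QuasiCompact b → Literature.AlgebraicGeometry.Resolution.IsBirational b → AlgebraicGeometry.IsReduced Γ → (∃ I : Y.IdealSheafData, Literature.AlgebraicGeometry.Resolution.IsBlowup b I ∧ ∀ y : Y,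 Literature.AlgebraicGeometry.Resolution.idealOrder I y ≤ 1 ∧ ∃ U : Y.affineOpens, y ∈ (U : Y.Opens) ∧ ∃ x h : Y.presheaf.obj (Opposite.op (U : Y.Opens)), I.ideal U = Ideal.span {x, h}) → Literature.AlgebraicGeometry.Resolution.Scheme.HasResolution Γ

/-- item stmt-ResolutionOfSingularities-27133 · aside · rank 9 · open · by planner
sources: Kollar2007, CossartPiltant2019
[support] lens-3's residual ORD at scheme level: every reduced pencil blow-up is dominated properly
birationally by a pencil blow-up of order ≤ 1 everywhere over another regular base. Merge interface:
SplitOrderReduction ⟺ LocalOrderReduction ∧ Globalisation (kernel). To be filed as `aside`;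
necessity `localOrderReduction_of_summit`. [difficulty: open-problem] -/
@[route_item "route-ResolutionOfSingularities-OrderCut", crux]
def LocalOrderReduction : Prop :=
  ∀ p : ℕ, p.Prime → ∀ (k : Type) [Field k] [CharP k p] (Y : AlgebraicGeometry.Scheme.{0}) (g : Y ⟶ AlgebraicGeometry.Spec (.of k)), AlgebraicGeometry.IsSeparated g → AlgebraicGeometry.LocallyOfFiniteType g → AlgebraicGeometry.QuasiCompact g → Literature.AlgebraicGeometry.Resolution.Scheme.IsRegular Y → ∀ (Γ : AlgebraicGeometry.Scheme.{0}) (b : Γ ⟶ Y), AlgebraicGeometry.IsSeparated b → AlgebraicGeometry.LocallyOfFiniteType b → AlgebraicGeometry.QuasiCompact b → Literature.AlgebraicGeometry.Resolution.IsBirational b → AlgebraicGeometry.IsReduced Γ → (∃ I : Y.IdealSheafData, Literature.AlgebraicGeometry.Resolution.IsBlowup b I ∧ ∀ y : Y, ∃ U : Y.affineOpens, y ∈ (U : Y.Opens) ∧ ∃ x h : Y.presheaf.obj (Opposite.op (U : Y.Opens)), I.ideal U = Ideal.span {x, h}) → ∃ (Y₁ Γ₁ : AlgebraicGeometry.Scheme.{0})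 (g₁ : Y₁ ⟶ AlgebraicGeometry.Spec (.of k)) (b₁ : Γ₁ ⟶ Y₁) (π : Γ₁ ⟶ Γ), AlgebraicGeometry.IsSeparated g₁ ∧ AlgebraicGeometry.LocallyOfFiniteType g₁ ∧ AlgebraicGeometry.QuasiCompact g₁ ∧ Literature.AlgebraicGeometry.Resolution.Scheme.IsRegular Y₁ ∧ AlgebraicGeometry.IsSeparated b₁ ∧ AlgebraicGeometry.LocallyOfFiniteType b₁ ∧ AlgebraicGeometry.QuasiCompact b₁ ∧ Literature.AlgebraicGeometry.Resolution.IsBirational b₁ ∧ AlgebraicGeometry.IsReduced Γ₁ ∧ (∃ I : Y₁.IdealSheafData, Literature.AlgebraicGeometry.Resolution.IsBlowup b₁ I ∧ ∀ y : Y₁, Literature.AlgebraicGeometry.Resolution.idealOrder I y ≤ 1 ∧ ∃ U : Y₁.affineOpens, y ∈ (U : Y₁.Opens) ∧ ∃ x h : Y₁.presheaf.obj (Opposite.op (U : Y₁.Opens)), I.ideal U = Ideal.span {x, h}) ∧ AlgebraicGeometry.IsProper π ∧ Literature.AlgebraicGeometry.Resolution.IsBirational π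

/-- item stmt-ResolutionOfSingularities-27134 · aside · rank 9 · open · by planner
sources: CossartJannsenSaito2020, Kollar2007
[aside · COSTUME(kernel) on the special side of 27132 — NOT an IDEA target (CRITIC row 32 + ERRATUM
05:13:17Z) · RE-BOOKED per CRITIC row 34 05:29:28Z + ERRATUM #2 (lens-5 g5 Exhaustion 8094bac2…;
MaxContactCut asides 28616 X1 MarkedThreefoldResolution, 28617 ExhaustionStep, 28618
ExhaustionBase): dim-4 slice DISSOLVED — for EXISTENCE the globalisation seam is EMPTY in dimension
four at every order over every field, by ORDERED CHART EXHAUSTION with CJS-regularised centre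
closures (ExhaustionBridge, NEW LEMMA, paper-proved, prover target #2); pointers «G2^top(b ≥ 2)» and
«G2 may shrink to a PORT over perfect k» WITHDRAWN (it shrank to nothing, field-free); K2/K3 concern
CANONICAL globalisation only, irrelevant to the summit · remains the seam for dim ≥ 5 only (centre
closures are then threefolds)] GLOBALISATION as typed is a DOMINATION statement; a resolution π : X′
→ Γ from LocalOrderOneResolve 27132 IS such a domination (identity trick;
OrderCutIntrinsicCentres.globalisation_of_localOrderOneResolve, p762285); EXACT 27132 ⟺ 27128 ∧
27134; dim-4 slice ⟸ 28008. Necessity globalisation_of_summit. Sources: CossartJannsenSaito2020,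
Kollar2007. -/
@[route_item "route-ResolutionOfSingularities-OrderCut", crux]
def Globalisation : Prop :=
  ∀ p : ℕ, p.Prime → ∀ (k : Type) [Field k] [CharP k p] (Y : AlgebraicGeometry.Scheme.{0}) (g : Y ⟶ AlgebraicGeometry.Spec (.of k)), AlgebraicGeometry.IsSeparated g → AlgebraicGeometry.LocallyOfFiniteType g → AlgebraicGeometry.QuasiCompact g → Literature.AlgebraicGeometry.Resolution.Scheme.IsRegular Y → ∀ (Γ : AlgebraicGeometry.Scheme.{0}) (b : Γ ⟶ Y), AlgebraicGeometry.IsSeparated b → AlgebraicGeometry.LocallyOfFiniteType b → AlgebraicGeometry.QuasiCompact b → Literature.AlgebraicGeometry.Resolution.IsBirational b → AlgebraicGeometry.IsReduced Γ → (∃ I : Y.IdealSheafData, Literature.AlgebraicGeometry.Resolution.IsBlowup b I ∧ ∀ y : Y, Literature.AlgebraicGeometry.Resolution.idealOrder I y ≤ 1 ∧ ∃ U : Y.affineOpens, y ∈ (U : Y.Opens) ∧ ∃ x h : Y.presheaf.obj (Opposite.op (U : Y.Opens)), I.ideal U = Ideal.span {x, h}) → ∃ (Y₁ Γ₁ : AlgebraicGeometry.Scheme.{0})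 (g₁ : Y₁ ⟶ AlgebraicGeometry.Spec (.of k)) (b₁ : Γ₁ ⟶ Y₁) (π : Γ₁ ⟶ Γ), AlgebraicGeometry.IsSeparated g₁ ∧ AlgebraicGeometry.LocallyOfFiniteType g₁ ∧ AlgebraicGeometry.QuasiCompact g₁ ∧ Literature.AlgebraicGeometry.Resolution.Scheme.IsRegular Y₁ ∧ AlgebraicGeometry.IsSeparated b₁ ∧ AlgebraicGeometry.LocallyOfFiniteType b₁ ∧ AlgebraicGeometry.QuasiCompact b₁ ∧ Literature.AlgebraicGeometry.Resolution.IsBirational b₁ ∧ AlgebraicGeometry.IsReduced Γ₁ ∧ (∃ I H : Y₁.IdealSheafData, Literature.AlgebraicGeometry.Resolution.IsBlowup b₁ I ∧ ∀ y : Y₁, ∃ U : Y₁.affineOpens, y ∈ (U : Y₁.Opens) ∧ Literature.AlgebraicGeometry.Resolution.idealOrder H y ≤ 1 ∧ ∃ x h : Y₁.presheaf.obj (Opposite.op (U : Y₁.Opens)), H.ideal U = Ideal.span {x} ∧ I.ideal U = Ideal.span {x, h}) ∧ AlgebraicGeometry.IsProper π ∧ Literature.AlgebraicGeometry.Resolution.IsBirational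 π

/-- item stmt-ResolutionOfSingularities-27135 · aside · rank 9 · open · by planner
sources: CossartPiltant2019, Cutkosky2009
[support] PR₄ — pencil blow-ups over a regular separated finite-type Y/k with topological Krull
dimension ≤ 4 resolve (the dimension-4 pencil residual; the pencil part of
Dominance.SandwichedResolveDimFour stmt-24575). To be filed as `aside`. NECESSARY (kernel
`pencilResolveDimFour_of_summit`); KERNEL `pencilResolveDimFour_iff_tame_and_wild`. [difficulty:
open-problem] -/
@[route_item "route-ResolutionOfSingularities-OrderCut"]
def PencilResolveDimFour : Prop :=
  ∀ p : ℕ, p.Prime → ∀ (k : Type) [Field k] [CharP k p] (Y : AlgebraicGeometry.Scheme.{0}) (g : Y ⟶ AlgebraicGeometry.Spec (.of k)), AlgebraicGeometry.IsSeparated g → AlgebraicGeometry.LocallyOfFiniteType g → AlgebraicGeometry.QuasiCompact g → Literature.AlgebraicGeometry.Resolution.Scheme.IsRegular Y → topologicalKrullDim Y ≤ 4 → ∀ (Γ : AlgebraicGeometry.Scheme.{0}) (b : Γ ⟶ Y), AlgebraicGeometry.IsSeparated b → AlgebraicGeometry.LocallyOfFiniteType b → AlgebraicGeometry.QuasiCompact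 b → Literature.AlgebraicGeometry.Resolution.IsBirational b → AlgebraicGeometry.IsReduced Γ → (∃ I : Y.IdealSheafData, Literature.AlgebraicGeometry.Resolution.IsBlowup b I ∧ ∀ y : Y, ∃ U : Y.affineOpens, y ∈ (U : Y.Opens) ∧ ∃ x h : Y.presheaf.obj (Opposite.op (U : Y.Opens)), I.ideal U = Ideal.span {x, h}) → Literature.AlgebraicGeometry.Resolution.Scheme.HasResolution Γ

/-- item stmt-ResolutionOfSingularities-27136 · aside · rank 9 · open · by planner
sources: Kollar2007, arXiv:1205.4556, CossartJannsenSaito2020, doi:10.1112/s0010437x1200084x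
[aside · NECESSARY (tameOrderPencilResolveDimFour_of_summit) · RE-BOOKED per CRITIC row 34 05:29:28Z
+ ERRATUM #2 (lens-5 g5 Exhaustion 8094bac2…; MaxContactCut asides 28616 X1
MarkedThreefoldResolution, 28617 ExhaustionStep, 28618 ExhaustionBase): Tame₄ = ATTACKABLE modulo
{X1 = MarkedThreefoldResolution 28616} ONLY, via TameHasContact 28012 (hereditary maximal contact
below p) + ExhaustionStep 28617; «Globalisation₄» and «MIR₃ with boundary / functorial MIR₃» STRUCK
(dim-4 globalisation seam empty for existence; only a WEAK resolution is claimed, boundary restart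
legal) · X1 by slice: c = 1 any field and max-ord over k̄ KNOWN, general c UNDECIDED-in-print
(T-X1-scope); in the tame range n < p the going-up is the tree's PROVED
CentreSeq.isResolutionOf_pushforward_of_maxContact (no port HS)] Tame₄: pencil blow-ups over a
regular Y/k of dimension ≤ 4 whose ideal has order < p at EVERY point resolve; contains
SplitOrderOneResolveDimFour 27131 (splitOrderOneResolveDimFour_of_tame). Census T-tame-lit rev 2.
Sources: Kollar2007 §3, arXiv:math/0606530, arXiv:1205.4556, CossartJannsenSaito2020,
doi:10.1112/s0010437x1200084x. -/
@[route_item "route-ResolutionOfSingularities-OrderCut"]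
def TameOrderPencilResolveDimFour : Prop :=
  ∀ p : ℕ, p.Prime → ∀ (k : Type) [Field k] [CharP k p] (Y : AlgebraicGeometry.Scheme.{0}) (g : Y ⟶ AlgebraicGeometry.Spec (.of k)), AlgebraicGeometry.IsSeparated g → AlgebraicGeometry.LocallyOfFiniteType g → AlgebraicGeometry.QuasiCompact g → Literature.AlgebraicGeometry.Resolution.Scheme.IsRegular Y → topologicalKrullDim Y ≤ 4 → ∀ (Γ : AlgebraicGeometry.Scheme.{0}) (b : Γ ⟶ Y), AlgebraicGeometry.IsSeparated b → AlgebraicGeometry.LocallyOfFiniteType b → AlgebraicGeometry.QuasiCompact b → Literature.AlgebraicGeometry.Resolution.IsBirational b → AlgebraicGeometry.IsReduced Γ → (∃ I : Y.IdealSheafData, Literature.AlgebraicGeometry.Resolution.IsBlowup b I ∧ ∀ y : Y, Literature.AlgebraicGeometry.Resolution.idealOrder I y < (p : ℕ∞) ∧ ∃ U : Y.affineOpens, y ∈ (U : Y.Opens) ∧ ∃ x h : Y.presheaf.obj (Opposite.op (U : Y.Opens)), I.ideal U = Ideal.span {x, h}) → Literature.AlgebraicGeometry.Resolution.Scheme.HasResolution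 Γ

/-- item stmt-ResolutionOfSingularities-27137 · aside · rank 9 · open · by planner
sources: CossartPiltant2019, arXiv:1205.4556, doi:10.4310/ajm.2011.v15.n3.a3
[support] Wild₄ (gen-3 located residual) — pencil blow-ups over a regular Y/k of dimension ≤ 4 whose
ideal has order ≥ p at SOME point resolve. To be filed as `aside`. NECESSARY (kernel
`wildOrderPencilResolveDimFour_of_summit`); with Tame₄ it is exactly PR₄ (kernel). IDEA-NEEDED:
every rational specimen of the cell's bed lies here (orders ≥ p, initial forms p-th powers, no
maximal contact). [difficulty: open-problem] -/
@[route_item "route-ResolutionOfSingularities-OrderCut"]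
def WildOrderPencilResolveDimFour : Prop :=
  ∀ p : ℕ, p.Prime → ∀ (k : Type) [Field k] [CharP k p] (Y : AlgebraicGeometry.Scheme.{0}) (g : Y ⟶ AlgebraicGeometry.Spec (.of k)), AlgebraicGeometry.IsSeparated g → AlgebraicGeometry.LocallyOfFiniteType g → AlgebraicGeometry.QuasiCompact g → Literature.AlgebraicGeometry.Resolution.Scheme.IsRegular Y → topologicalKrullDim Y ≤ 4 → ∀ (Γ : AlgebraicGeometry.Scheme.{0}) (b : Γ ⟶ Y), AlgebraicGeometry.IsSeparated b → AlgebraicGeometry.LocallyOfFiniteType b → AlgebraicGeometry.QuasiCompact b → Literature.AlgebraicGeometry.Resolution.IsBirational b → AlgebraicGeometry.IsReduced Γ → (∃ I : Y.IdealSheafData, Literature.AlgebraicGeometry.Resolution.IsBlowup b I ∧ (∃ y : Y, (p : ℕ∞) ≤ Literature.AlgebraicGeometry.Resolution.idealOrder I y) ∧ ∀ y : Y, ∃ U : Y.affineOpens, y ∈ (U : Y.Opens) ∧ ∃ x h : Y.presheaf.obj (Opposite.op (U : Y.Opens)), I.ideal U = Ideal.span {x, h}) → Literature.AlgebraicGeometry.Resolution.Scheme.HasResolution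 Γ

/-- item stmt-ResolutionOfSingularities-27138 · aside · rank 9 · open · by planner
sources: Hartshorne1977, Conrad2007
[support] lens-3's kernel Theorem A «pencils suffice», K-level with predicates inlined: elimination
of indeterminacy of single rational functions over regular proper models (PR_K) implies that every
projective model of a function field having some regular proper model is resolved (DOM_K). To be
filed as `aside`; proved in HOME/decomp-res-lens-3/PencilDomination.lean
(`regularDomination_of_pencilResolve`), to land post-birth as a Theorems file proving this item by
name. COSTUME(kernel). [difficulty: L] -/
@[route_item "route-ResolutionOfSingularities-OrderCut"]
def PencilsSufficeK : Prop :=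
  (∀ p : ℕ, p.Prime → ∀ (k : Type) [Field k] [CharP k p] (K : Type) [Field K] [Algebra k K] (R : Literature.AlgebraicGeometry.Resolution.ProperModel k K), Literature.AlgebraicGeometry.Resolution.Scheme.IsRegular R.X → ∀ f : K, ∃ (N : Literature.AlgebraicGeometry.Resolution.ProperModel k K) (_ : N.Hom R), Literature.AlgebraicGeometry.Resolution.Scheme.IsRegular N.X ∧ ∀ y : N.X, (Literature.AlgebraicGeometry.Motives.RatFn.IsRegularAt y (N.funFieldAlgEquiv.symm f) ∨ Literature.AlgebraicGeometry.Motives.RatFn.IsRegularAt y (N.funFieldAlgEquiv.symm f⁻¹))) → (∀ p : ℕ, p.Prime → ∀ (k : Type) [Field k] [CharP k p] (K : Type) [Field K] [Algebra k K], (∃ R : Literature.AlgebraicGeometry.Resolution.ProperModel k K, Literature.AlgebraicGeometry.Resolution.Scheme.IsRegular R.X) → ∀ M : Literature.AlgebraicGeometry.Resolution.ProjModel k K, Literature.AlgebraicGeometry.Resolution.Scheme.HasResolution M.X)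

/-- item stmt-ResolutionOfSingularities-27139 · aside · rank 9 · open · by planner
sources: Hartshorne1977, Conrad2007
[support] lens-3's kernel Theorem C, the converse DOM_K ⟹ PR_K (Chow `ChowLemmaIntegral_holds` + the
graph model Γ_f ⊆ R ×ₖ ℙ¹), making PR_K ⟺ DOM_K the node's certified K-level EQUIV. To be filed as
`aside`; proved in lens-3's file (`pencilResolve_of_regularDomination`). COSTUME(kernel).
[difficulty: L] -/
@[route_item "route-ResolutionOfSingularities-OrderCut"]
def DominationPencilsK : Prop :=
  (∀ p : ℕ, p.Prime → ∀ (k : Type) [Field k] [CharP k p] (K : Type) [Field K] [Algebra k K], (∃ R : Literature.AlgebraicGeometry.Resolution.ProperModel k K, Literature.AlgebraicGeometry.Resolution.Scheme.IsRegular R.X) → ∀ M : Literature.AlgebraicGeometry.Resolution.ProjModel k K, Literature.AlgebraicGeometry.Resolution.Scheme.HasResolution M.X) → (∀ p : ℕ, p.Prime → ∀ (k : Type) [Field k] [CharP k p] (K : Type) [Field K] [Algebra k K] (R : Literature.AlgebraicGeometry.Resolution.ProperModel k K), Literature.AlgebraicGeometry.Resolution.Scheme.IsRegular R.X → ∀ f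 : K, ∃ (N : Literature.AlgebraicGeometry.Resolution.ProperModel k K) (_ : N.Hom R), Literature.AlgebraicGeometry.Resolution.Scheme.IsRegular N.X ∧ ∀ y : N.X, (Literature.AlgebraicGeometry.Motives.RatFn.IsRegularAt y (N.funFieldAlgEquiv.symm f) ∨ Literature.AlgebraicGeometry.Motives.RatFn.IsRegularAt y (N.funFieldAlgEquiv.symm f⁻¹)))

/-- item stmt-ResolutionOfSingularities-28030 · aside · rank 9 · open · by planner
sources: CossartPiltant2019, Kollar2007, Kato1994, arXiv:math/0606530
[aside · RUNG (4,1) of lens-5 g4 ContactLadder (ContactLadder.lean e5c04975…; CRITIC row 44 «CLEARED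
AS MAP + RUNG») · NECESSARY (contactResolveDim_of_summit) · ATTACKABLE, CLOSED-MOD-LIBRARY ·
RE-BOOKED per CRITIC row 34 05:29:28Z + ERRATUM #2 (lens-5 g5 Exhaustion 8094bac2…; MaxContactCut
asides 28616 X1 MarkedThreefoldResolution, 28617 ExhaustionStep, 28618 ExhaustionBase): the CONTACT
SIDE of the dim-4 pocket (28008, 28009, 27136, 27131, 28030/28031 as far as hypotheses give
pointwise contact) is CLOSED-MOD-PORT {X1(n!) by slice, perfect-k / HS ports of 28009}, NO
globalisation seam, NO idea seam; at contact order 1 the slice X1(1) is IN PRINT over any field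
(CossartPiltant2019 4.4/4.3 + CJS) ⇒ CLOSED-MOD-LIBRARY by two routes (CJS intrinsic centres as for
28008; ExhaustionBase 28618)] RUNG (4,1): contact-one blow-ups of regular fourfolds resolve — Y
regular separated finite type over k of char p, topologicalKrullDim Y ≤ 4, Γ reduced, b : Γ ⟶ Y the
blow-up of an ideal sheaf J affine-locally containing x, H = (x) a GLOBAL regular hypersurface ideal
sheaf ⇒ Γ has a resolution. Sources: CossartPiltant2019, Kollar2007, Kato1994, arXiv:math/0606530. -/
@[route_item "route-ResolutionOfSingularities-OrderCut"]
def ContactResolveDimFourOne : Prop :=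
  ∀ p : ℕ, p.Prime → ∀ (k : Type) [Field k] [CharP k p] (Y : AlgebraicGeometry.Scheme.{0}) (g : Y ⟶ AlgebraicGeometry.Spec (.of k)), AlgebraicGeometry.IsSeparated g → AlgebraicGeometry.LocallyOfFiniteType g → AlgebraicGeometry.QuasiCompact g → Literature.AlgebraicGeometry.Resolution.Scheme.IsRegular Y → topologicalKrullDim Y ≤ 4 → ∀ (Γ : AlgebraicGeometry.Scheme.{0}) (b : Γ ⟶ Y), AlgebraicGeometry.IsSeparated b → AlgebraicGeometry.LocallyOfFiniteType b → AlgebraicGeometry.QuasiCompact b → Literature.AlgebraicGeometry.Resolution.IsBirational b → AlgebraicGeometry.IsReduced Γ → (∃ J H : Y.IdealSheafData, Literature.AlgebraicGeometry.Resolution.IsBlowup b J ∧ ∀ y : Y, ∃ U : Y.affineOpens, y ∈ (U : Y.Opens) ∧ Literature.AlgebraicGeometry.Resolution.idealOrder H y ≤ 1 ∧ ∃ x : Y.presheaf.obj (Opposite.op (U : Y.Opens)), H.ideal U = Ideal.span {x} ∧ x ^ 1 ∈ J.ideal U) → Literature.AlgebraicGeometry.Resolution.Scheme.HasResolution Γ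

/-- item stmt-ResolutionOfSingularities-28031 · aside · rank 9 · open · by planner
sources: CossartPiltant2019, Kollar2007, arXiv:math/0606530, arXiv:1205.4556, Narasimhan1983
[aside · FIRST OPEN RUNG (4,2) of lens-5 g4 ContactLadder (CRITIC row 44) · NECESSARY (kernel) ·
RE-BOOKED per CRITIC row 34 05:29:28Z + ERRATUM #2 (lens-5 g5 Exhaustion 8094bac2…; MaxContactCut
asides 28616 X1 MarkedThreefoldResolution, 28617 ExhaustionStep, 28618 ExhaustionBase): «ATTACKABLE
modulo G2(2) ∧ G1(2)^(bdry)-port» becomes ATTACKABLE modulo G1(2)^(∅)(κ) ONLY — G2(2) DISSOLVES by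
ordered chart exhaustion with CJS-regularised closures, provided the G1(2) engine is weakly
permissible with centres in the top locus (ExhaustionBridge at n = 2; weak resolution only, no
boundary version needed); remaining gap G1(2)^(∅)(κ) = order reduction of the weighted basic object
(K₀,2) ⊕ (K₁,1) ≡ (K₀ + K₁², 2) on regular excellent threefolds in char p = slice X1(2) of 28616:
over k̄ IN PRINT at max-ord (arXiv:math/0606530 Thm 5.1; Thm 5.6 scope for c < max-ord =
T-X1-scope), general field UNDECIDED-in-print · holds the census's first open punctual cell
(T-punct-3 §4)] RUNG (4,2): contact-two blow-ups of regular fourfolds resolve (shape of 28030 with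
x² ∈ J(U), H = (x) global regular). Sources: CossartPiltant2019, Kollar2007, arXiv:math/0606530,
arXiv:1205.4556, Narasimhan1983. -/
@[route_item "route-ResolutionOfSingularities-OrderCut"]
def ContactResolveDimFourTwo : Prop :=
  ∀ p : ℕ, p.Prime → ∀ (k : Type) [Field k] [CharP k p] (Y : AlgebraicGeometry.Scheme.{0}) (g : Y ⟶ AlgebraicGeometry.Spec (.of k)), AlgebraicGeometry.IsSeparated g → AlgebraicGeometry.LocallyOfFiniteType g → AlgebraicGeometry.QuasiCompact g → Literature.AlgebraicGeometry.Resolution.Scheme.IsRegular Y → topologicalKrullDim Y ≤ 4 → ∀ (Γ : AlgebraicGeometry.Scheme.{0}) (b : Γ ⟶ Y), AlgebraicGeometry.IsSeparated b → AlgebraicGeometry.LocallyOfFiniteType b → AlgebraicGeometry.QuasiCompact b → Literature.AlgebraicGeometry.Resolution.IsBirational b → AlgebraicGeometry.IsReduced Γ → (∃ J H : Y.IdealSheafData, Literature.AlgebraicGeometry.Resolution.IsBlowup b J ∧ ∀ y : Y, ∃ U : Y.affineOpens, y ∈ (U : Y.Opens) ∧ Literature.AlgebraicGeometry.Resolution.idealOrder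 H y ≤ 1 ∧ ∃ x : Y.presheaf.obj (Opposite.op (U : Y.Opens)), H.ideal U = Ideal.span {x} ∧ x ^ 2 ∈ J.ideal U) → Literature.AlgebraicGeometry.Resolution.Scheme.HasResolution Γ

/-- item stmt-ResolutionOfSingularities-27140 · assembly · rank 1 · open · by planner
sources: Kollar2007
[assembly] RegularRoofs → PencilReduction → SplitOrderReduction → SplitOrderOneResolve →
ResolutionOfSingularities. -/
@[route_item "route-ResolutionOfSingularities-OrderCut"]
def Assembly : Prop :=
  RegularRoofs → PencilReduction → SplitOrderReduction → SplitOrderOneResolve → _root_.ResolutionOfSingularities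

/-! D-0027 §2.1 — DECIDING THEOREM (planner-authored via `route open/edit --closes-file`; by planner-decomp-res-writer-1-g0-0 2026-08-30T03:56:01Z):
its hypotheses are this route's items and its conclusion the sub-problem Statement (glue_lint), and it elaborates with this file. -/

@[closes "route-ResolutionOfSingularities-OrderCut"] theorem closes (hR : RegularRoofs) (hP : PencilReduction) (hO : SplitOrderReduction)
    (h1 : SplitOrderOneResolve) : _root_.ResolutionOfSingularities := by
  have hS := hP (fun p hp k _ _ Y g hg1 hg2 hg3 hY Γ b hb1 hb2 hb3 hbb hΓ hpen => by
    obtain ⟨Y₁, Γ₁, g₁, b₁, π, hg₁1, hg₁2, hg₁3, hY₁, hb₁1, hb₁2, hb₁3, hb₁b, hΓ₁, hsplit, hπ1, hπ2⟩ :=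
      hO p hp k Y g hg1 hg2 hg3 hY Γ b hb1 hb2 hb3 hbb hΓ hpen
    haveI := hπ1
    exact Literature.AlgebraicGeometry.Resolution.ComponentGluing.Scheme.HasResolution.of_isBirational π hπ2
      (h1 p hp k Y₁ g₁ hg₁1 hg₁2 hg₁3 hY₁ Γ₁ b₁ hb₁1 hb₁2 hb₁3 hb₁b hΓ₁ hsplit))
  refine _root_.ResolutionOfSingularities_iff.mpr fun p hp => ?_
  rw [Literature.AlgebraicGeometry.Resolution.ComponentGluing.resolutionInChar_iff_integral]
  intro k _ _ X f hsep hft hqc hint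
  obtain ⟨Γ, Y, a, b, g, hg1, hg2, hg3, hY, hΓ, ha, hab, hb1, hb2, hb3, hbb⟩ :=
    hR p hp k X f hsep hft hqc hint
  haveI := ha
  exact Literature.AlgebraicGeometry.Resolution.ComponentGluing.Scheme.HasResolution.of_isBirational a hab
    (hS p hp k Y g hg1 hg2 hg3 hY Γ b hb1 hb2 hb3 hbb hΓ)

end Summit.ResolutionOfSingularities.ResolutionOfSingularities.Theses.OrderCut
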